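import Mathlib.GroupTheory.Perm.Cycle.Basic
import Mathlib.GroupTheory.OrderOfElement

/-!
# Route «KPlusLogSqLaw», crux `TropicalB` (stmt-ValiantsHypothesis-19771) — MARKED-EDGE sector, NESTED-TRIANGLE CORE, ALL sizes:
# the Q-COVER THEOREM (g18's «S3*»), part A — orbit lemma, TRUNK DICHOTOMY, and the three trunk-incompatibility lemmas

HONEST FRAMING.  Helper file (cell `pub-symmetroid`, seat val-sym-trop-p4 (g19), 2026-08-29; `--supports stmt-ValiantsHypothesis-19771 --as
helper`).  Pure permutation combinatorics (no weights, no slopes): the abstract toolkit from which parts B (Hall step, separation, reachability)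
and C (assembly on the realisation hypotheses: `core_Q_exists`) derive g18's located sub-claim **S3\*** («in any realisation of the nested-triangle
core {1,2},{1,3},{2,3},{0,4} — indeed for any four permutations with the core's marked-loop patterns, the three triangle pairs differing by single
cycles and the three Z-rigidities — a Q-cover of pattern {b1,b4} exists inside `σB ⊎ σC ⊎ σZ`, or one of pattern {b2,b4} inside
`σB ⊎ σE ⊎ σZ`, or one of pattern {b3,b4} inside `σC ⊎ σE ⊎ σZ`», memo ALLM-STRUCTURE-g18 §4b, S3STAR-PROBLEM.md).  Nothing here proves the law
(the P-completion remains); nothing concerns `TropicalB` in its window, `WeakLifting`, the doors, `MatrixDescartes` (stmt-ValiantsHypothesis-18050)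
or VP ≠ VNP.

SETTING OF THIS PART.  A finite type `V`, permutations `φ, ψ, χ, ξ, η : Equiv.Perm V`, a «gate» `s` (in the application `s = b4`), a «marked
arc» `b ↦ z` shared by the two colours of a pair (`ξ b = η b = z`), and a finset `F ⊆ V ∖ {s}` that is PRED-CLOSED for the pair
(`ξ u ∈ F → u ∈ F ∨ u = s`, same for `η`) with `b ∈ F`, `z ∉ F` (an «A1-witness»: it certifies that `b` is not reachable from the other gate).

CONTENTS.
* `orbit_exit` — the orbit lemma: if every step from `x₀` or from the safe region `P` stays in `P` or hits the target `t`, and `x₀ ∉ P`, then the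
  `φ`-orbit of `x₀` hits `t` after running inside `P`.
* `witness_image`, `witness_step` — for an A1-witness, `φ '' (F ∪ {s}) = F ∪ {z}` (`φ ∈ {ξ, η}`).
* `witness_positions` — on the BACKWARD `φ`-orbit of `s` one meets `z` and then `b` before any point of `F`.
* **`trunk_dichotomy`** — if `ξ⁻¹η` is a cycle (the pair differs by ONE alternating cycle): either the TRUNK (`ξ^i s = η^i s` for all
  `i ≤ n+1`, with `ξ^n s = b`, `ξ^{n+1} s = z`) or the CO-TRUNK (any two prescribed points moved by `ξ⁻¹η` lie in `F`).
* `two_trunks_false`, `two_cotrunks_false`, `cotrunk_trunk_false` — the three incompatibility lemmas of the proof of S3\* (see part C).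
All statements are about ONE permutation `φ` (or a pair/triple) and are instantiated in part C for each colour, forwards and — replacing every
permutation by its inverse and swapping `b ↔ z` — backwards.
-/

set_option linter.dupNamespace false
set_option autoImplicit false

namespace Summit.ValiantsHypothesis.ValiantsHypothesis.Theorems.KPlusLogSqLaw
namespace MarkedEdge
namespace Core
namespace QCover

open Finset

variable {V : Type*} [Fintype V] [DecidableEq V]

/-! ### The orbit lemma -/

omit [DecidableEq V] in
/-- **Orbit lemma.**  Let `φ` be a permutation of a finite type, `P` a «safe» predicate, `x₀` a start with `¬ P x₀` and `t` a target.  If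
`φ` maps `x₀` and every safe point to a safe point or to `t`, then the orbit of `x₀` reaches `t` at some time `n ≥ 1`, having been safe at
all times `1 ≤ i < n`. [folklore] -/
theorem orbit_exit (φ : Equiv.Perm V) (P : V → Prop) (x₀ t : V)
    (hstep : ∀ v, (v = x₀ ∨ P v) → (P (φ v) ∨ φ v = t)) (h0 : ¬ P x₀) :
    ∃ n, 1 ≤ n ∧ (φ ^ n) x₀ = t ∧ ∀ i, 1 ≤ i → i < n → P ((φ ^ i) x₀) := by
  classical
  have hN : ∃ i, 1 ≤ i ∧ ¬ P ((φ ^ i) x₀) :=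
    ⟨orderOf φ, orderOf_pos φ, by rw [pow_orderOf_eq_one]; simpa using h0⟩
  refine ⟨Nat.find hN, (Nat.find_spec hN).1, ?_, fun i h1 h2 => ?_⟩
  · obtain ⟨hn1, hnP⟩ := Nat.find_spec hN
    set n := Nat.find hN with hn
    have hprev : (φ ^ (n - 1)) x₀ = x₀ ∨ P ((φ ^ (n - 1)) x₀) := by
      rcases Nat.eq_or_lt_of_le hn1 with h | h
      · left
        rw [← h]
        simp
      · right
        by_contra hP
        exact Nat.find_min hN (show n - 1 < n by omega) ⟨by omega, hP⟩
    have key := hstep _ hprev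
    rw [← Equiv.Perm.mul_apply, ← pow_succ', Nat.sub_add_cancel hn1] at key
    exact key.resolve_left hnP
  · by_contra hP
    exact Nat.find_min hN h2 ⟨h1, hP⟩

/-! ### A1-witnesses: image, exit, positions -/

omit [Fintype V] in
/-- **Image of an A1-witness.**  If `F ∌ s, z` is pred-closed for `φ` up to the gate `s` and contains `b` with `φ b = z`, then
`φ '' (F ∪ {s}) = F ∪ {z}`. [this seat's lemma] -/
theorem witness_image (φ : Equiv.Perm V) (F : Finset V) (s b z : V) (hb : b ∈ F) (hz : z ∉ F) (hs : s ∉ F)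
    (hφb : φ b = z) (hpred : ∀ u, φ u ∈ F → u ∈ F ∨ u = s) :
    (insert s F).image φ = insert z F := by
  symm
  apply Finset.eq_of_subset_of_card_le
  · intro v hv
    rw [Finset.mem_insert] at hv
    rcases hv with rfl | hv
    · exact Finset.mem_image.mpr ⟨b, Finset.mem_insert_of_mem hb, hφb⟩
    · rcases hpred (φ.symm v) (by simpa using hv) with h | h
      · exact Finset.mem_image.mpr ⟨φ.symm v, Finset.mem_insert_of_mem h, by simp⟩
      · exact Finset.mem_image.mpr ⟨s, Finset.mem_insert_self _ _, by rw [← h]; simp⟩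
  · rw [Finset.card_image_of_injective _ φ.injective, Finset.card_insert_of_notMem hs,
      Finset.card_insert_of_notMem hz]

omit [Fintype V] in
/-- **Exit of an A1-witness.**  Every point of `F ∪ {s}` other than `b` is mapped into `F`. [this seat's lemma] -/
theorem witness_step (φ : Equiv.Perm V) (F : Finset V) (s b z : V) (hb : b ∈ F) (hz : z ∉ F) (hs : s ∉ F)
    (hφb : φ b = z) (hpred : ∀ u, φ u ∈ F → u ∈ F ∨ u = s) (u : V) (hu : u ∈ insert s F) (hub : u ≠ b) :
    φ u ∈ F := by
  have h : φ u ∈ (insert s F).image φ := Finset.mem_image_of_mem _ hu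
  rw [witness_image φ F s b z hb hz hs hφb hpred, Finset.mem_insert] at h
  rcases h with h | h
  · exact absurd (φ.injective (h.trans hφb.symm)) hub
  · exact h

/-- **Positions on the backward orbit.**  For an A1-witness, the backward `φ`-orbit of the gate `s` meets `z` (at some time `q ≥ 1`) and then
`b` (at time `q+1`) before meeting any point of `F`. [this seat's lemma] -/
theorem witness_positions (φ : Equiv.Perm V) (F : Finset V) (s b z : V) (hb : b ∈ F) (hz : z ∉ F) (hs : s ∉ F)
    (hzs : z ≠ s) (hφb : φ b = z) (hpred : ∀ u, φ u ∈ F → u ∈ F ∨ u = s) :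
    ∃ q, 1 ≤ q ∧ (φ⁻¹ ^ q) s = z ∧ (φ⁻¹ ^ (q + 1)) s = b ∧ ∀ i, 1 ≤ i → i ≤ q → (φ⁻¹ ^ i) s ∉ F := by
  have himg := witness_image φ F s b z hb hz hs hφb hpred
  -- a point outside `F ∪ {z}` has its preimage outside `F ∪ {s}`
  have hout : ∀ v, v ∉ insert z F → φ⁻¹ v ∉ insert s F := by
    intro v hv hc
    apply hv
    rw [← himg]
    exact Finset.mem_image.mpr ⟨φ⁻¹ v, hc, by simp⟩
  obtain ⟨n, hn1, hnz, hsafe⟩ := orbit_exit φ⁻¹ (fun v => v ∉ F ∧ v ≠ s ∧ v ≠ z) s z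
    (by
      intro v hv
      have hv' : v ∉ insert z F := by
        rcases hv with rfl | ⟨h1, _, h3⟩
        · simp [hs, hzs.symm]
        · simp [h1, h3]
      have := hout v hv'
      rw [Finset.mem_insert, not_or] at this
      by_cases h : φ⁻¹ v = z
      · exact Or.inr h
      · exact Or.inl ⟨this.2, this.1, h⟩)
    (by simp)
  refine ⟨n, hn1, hnz, ?_, fun i h1 h2 => ?_⟩
  · rw [pow_succ', Equiv.Perm.mul_apply, hnz, Equiv.Perm.inv_eq_iff_eq, hφb]
  · rcases Nat.lt_or_ge i n with h | h
    · exact (hsafe i h1 h).1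
    · have : i = n := le_antisymm h2 h
      rw [this, hnz]
      exact hz

/-! ### The trunk dichotomy -/

omit [Fintype V] [DecidableEq V] in
/-- `ξ⁻¹η` fixes `v` iff `ξ v = η v`. [folklore] -/
theorem rel_fix_iff (ξ η : Equiv.Perm V) (v : V) : (ξ⁻¹ * η) v = v ↔ ξ v = η v := by
  rw [Equiv.Perm.mul_apply, Equiv.Perm.inv_eq_iff_eq]
  exact eq_comm

/-- **Trunk dichotomy.**  Let `F` be an A1-witness for the pair `(ξ, η)` at the marked arc `b ↦ z` (gate `s`), and let `ξ⁻¹η` be a cycle.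
Then EITHER the two colours agree along the whole initial orbit segment of the gate up to the marked arc — the TRUNK: `ξ^i s = η^i s` for
`i ≤ n+1`, `ξ^n s = b`, `ξ^{n+1} s = z` — OR any two prescribed points `p₁, p₂ ≠ s` moved by `ξ⁻¹η` lie in `F` (the CO-TRUNK).
Mechanism: `F ∪ {s}` is `ξ⁻¹η`-invariant (both colours map it onto `F ∪ {z}`), so the unique nontrivial cycle lies inside or outside.
[this seat's lemma] -/
theorem trunk_dichotomy (ξ η : Equiv.Perm V) (F : Finset V) (s b z p₁ p₂ : V) (hb : b ∈ F) (hz : z ∉ F) (hs : s ∉ F)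
    (hξb : ξ b = z) (hηb : η b = z)
    (hpredξ : ∀ u, ξ u ∈ F → u ∈ F ∨ u = s) (hpredη : ∀ u, η u ∈ F → u ∈ F ∨ u = s)
    (hcyc : (ξ⁻¹ * η).IsCycle) (hp₁ : ξ p₁ ≠ η p₁) (hp₂ : ξ p₂ ≠ η p₂) (hp₁s : p₁ ≠ s) (hp₂s : p₂ ≠ s) :
    (∃ n, (∀ i, i ≤ n + 1 → (ξ ^ i) s = (η ^ i) s) ∧ (ξ ^ n) s = b ∧ (ξ ^ (n + 1)) s = z) ∨ (p₁ ∈ F ∧ p₂ ∈ F) := by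
  set S := insert s F with hS
  have hSξ : S.image ξ = insert z F := witness_image ξ F s b z hb hz hs hξb hpredξ
  have hSη : S.image η = insert z F := witness_image η F s b z hb hz hs hηb hpredη
  set δ := ξ⁻¹ * η with hδ
  -- invariance of `S` under `δ`
  have hinv : ∀ v, δ v ∈ S ↔ v ∈ S := by
    intro v
    have h1 : δ v ∈ S ↔ η v ∈ S.image ξ := by
      rw [hδ, Equiv.Perm.mul_apply]
      constructor
      · intro h
        exact Finset.mem_image.mpr ⟨_, h, by simp⟩
      · intro h
        obtain ⟨u, hu, hu'⟩ := Finset.mem_image.mp h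
        have : u = ξ⁻¹ (η v) := by rw [Equiv.Perm.eq_inv_iff_eq]; exact hu'
        rw [← this]
        exact hu
    have h2 : η v ∈ S.image η ↔ v ∈ S := by
      constructor
      · intro h
        obtain ⟨u, hu, hu'⟩ := Finset.mem_image.mp h
        rw [← η.injective hu']
        exact hu
      · intro h
        exact Finset.mem_image_of_mem _ h
    rw [h1, hSξ, ← hSη, h2]
  have hinv_pow : ∀ (k : ℕ) (v : V), (δ ^ k) v ∈ S ↔ v ∈ S := by
    intro k
    induction k with
    | zero => intro v; simp
    | succ k ih => intro v; rw [pow_succ', Equiv.Perm.mul_apply, hinv, ih]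
  obtain ⟨x, hx, hall⟩ := hcyc
  have hmoved : ∀ p, ξ p ≠ η p → δ p ≠ p := fun p hp h => hp ((rel_fix_iff ξ η p).mp h)
  by_cases hxS : x ∈ S
  · -- the cycle is inside `S`: co-trunk
    right
    have hin : ∀ p, ξ p ≠ η p → p ≠ s → p ∈ F := by
      intro p hp hps
      obtain ⟨i, hi⟩ := Equiv.Perm.IsCycle.exists_pow_eq ⟨x, hx, hall⟩ hx (hmoved p hp)
      have : p ∈ S := by rw [← hi]; exact (hinv_pow i x).mpr hxS
      rw [hS, Finset.mem_insert] at this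
      exact this.resolve_left hps
    exact ⟨hin p₁ hp₁ hp₁s, hin p₂ hp₂ hp₂s⟩
  · -- the cycle is outside `S`: the colours agree on `S`, trunk
    left
    have hagree : ∀ v, v ∈ S → ξ v = η v := by
      intro v hv
      by_contra hne
      obtain ⟨i, hi⟩ := Equiv.Perm.IsCycle.exists_pow_eq ⟨x, hx, hall⟩ hx (hmoved v hne)
      exact hxS ((hinv_pow i x).mp (by rw [hi]; exact hv))
    obtain ⟨n, hn1, hnz, hsafe⟩ := orbit_exit ξ (fun v => v ∈ F) s z
      (by
        intro v hv
        have hvS : v ∈ S := by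
          rcases hv with rfl | hv
          · exact Finset.mem_insert_self _ _
          · exact Finset.mem_insert_of_mem hv
        have : ξ v ∈ S.image ξ := Finset.mem_image_of_mem _ hvS
        rw [hSξ, Finset.mem_insert] at this
        exact this.symm)
      hs
    refine ⟨n - 1, fun i hi => ?_, ?_, by rw [Nat.sub_add_cancel hn1]; exact hnz⟩
    · -- agreement along the orbit, by induction
      induction i with
      | zero => simp
      | succ i ih =>
        have hi' : i < n := by omega
        have hmem : (ξ ^ i) s ∈ S := by
          rcases Nat.eq_zero_or_pos i with h | h
          · rw [h]; simp [hS]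
          · exact Finset.mem_insert_of_mem (hsafe i h hi')
        rw [pow_succ', pow_succ', Equiv.Perm.mul_apply, Equiv.Perm.mul_apply, ← ih (by omega), hagree _ hmem]
    · apply ξ.injective
      rw [← Equiv.Perm.mul_apply, ← pow_succ', Nat.sub_add_cancel hn1, hnz, hξb]

/-! ### The three incompatibility lemmas -/

omit [Fintype V] [DecidableEq V] in
/-- **Two trunks on one colour are incompatible.**  If the `φ`-orbit of `s` agrees with `ψ` up to the arc `b ↦ z` and with `χ` up to the arc
`c ↦ w` (`b ≠ c`), then the shorter trunk is continued by the other companion: `χ b = z` or `ψ c = w`. [this seat's lemma] -/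
theorem two_trunks_false (φ ψ χ : Equiv.Perm V) (s b z c w : V) (n m : ℕ)
    (hT₁ : ∀ i, i ≤ n + 1 → (φ ^ i) s = (ψ ^ i) s) (hnb : (φ ^ n) s = b) (hnz : (φ ^ (n + 1)) s = z)
    (hT₂ : ∀ i, i ≤ m + 1 → (φ ^ i) s = (χ ^ i) s) (hmc : (φ ^ m) s = c) (hmw : (φ ^ (m + 1)) s = w)
    (hχ : χ b ≠ z) (hψ : ψ c ≠ w) (hbc : b ≠ c) : False := by
  rcases lt_trichotomy n m with h | h | h
  · apply hχ
    rw [← hnb, hT₂ n (by omega), ← Equiv.Perm.mul_apply, ← pow_succ', ← hT₂ (n + 1) (by omega), hnz]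
  · exact hbc (by rw [← hnb, ← hmc, h])
  · apply hψ
    rw [← hmc, hT₁ m (by omega), ← Equiv.Perm.mul_apply, ← pow_succ', ← hT₁ (m + 1) (by omega), hmw]

omit [Fintype V] [DecidableEq V] in
/-- **Two co-trunks on one colour are incompatible.**  Positions on the `φ`-orbit of `s`: `b` at time `q` preceded only by points outside `F`,
`c` at time `r` preceded only by points outside `G`; if `c ∈ F` and `b ∈ G` (`b ≠ c`), contradiction. [this seat's lemma] -/
theorem two_cotrunks_false (φ : Equiv.Perm V) (s : V) (F G : Finset V) (b c : V) (q r : ℕ) (hq : 1 ≤ q) (hr : 1 ≤ r)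
    (hqb : (φ ^ q) s = b) (hF : ∀ i, 1 ≤ i → i < q → (φ ^ i) s ∉ F)
    (hrc : (φ ^ r) s = c) (hG : ∀ i, 1 ≤ i → i < r → (φ ^ i) s ∉ G)
    (hcF : c ∈ F) (hbG : b ∈ G) (hbc : b ≠ c) : False := by
  rcases lt_trichotomy q r with h | h | h
  · exact hG q hq h (by rw [hqb]; exact hbG)
  · exact hbc (by rw [← hqb, ← hrc, h])
  · exact hF r hr h (by rw [hrc]; exact hcF)

omit [Fintype V] [DecidableEq V] in
/-- **A co-trunk and a trunk on one colour are incompatible.**  Positions of the co-trunk: `z` at time `q ≥ 1`, `b` at time `q+1`, nothing of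
`F` at times `1 … q` (and `s ∉ F`); a trunk of `(φ, ψ)` (agreement up to time `n+1`) passing `w ∈ F` at time `n` forces `n > q`,
whence `ψ` continues `z ↦ b`.
[this seat's lemma] -/
theorem cotrunk_trunk_false (φ ψ : Equiv.Perm V) (s : V) (F : Finset V) (b z w : V) (q n : ℕ)
    (hqz : (φ ^ q) s = z) (hqb : (φ ^ (q + 1)) s = b) (hF : ∀ i, 1 ≤ i → i ≤ q → (φ ^ i) s ∉ F) (hsF : s ∉ F)
    (hwF : w ∈ F) (hT : ∀ i, i ≤ n + 1 → (φ ^ i) s = (ψ ^ i) s) (hnw : (φ ^ n) s = w)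
    (hψ : ψ z ≠ b) : False := by
  have hn : q + 1 ≤ n := by
    by_contra h
    push Not at h
    rcases Nat.eq_zero_or_pos n with h0 | h0
    · apply hsF
      rw [h0, pow_zero, Equiv.Perm.one_apply] at hnw
      rw [hnw]
      exact hwF
    · exact hF n h0 (by omega) (by rw [hnw]; exact hwF)
  apply hψ
  rw [← hqz, hT q (by omega), ← Equiv.Perm.mul_apply, ← pow_succ', ← hT (q + 1) (by omega), hqb]

omit [Fintype V] [DecidableEq V] in
/-- A trunk of `(ξ, η)` is a trunk of `(η, ξ)`. [folklore] -/
theorem trunk_symm (ξ η : Equiv.Perm V) (s b z : V) (n : ℕ) (h : ∀ i, i ≤ n + 1 → (ξ ^ i) s = (η ^ i) s)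
    (hb : (ξ ^ n) s = b) (hz : (ξ ^ (n + 1)) s = z) :
    (∀ i, i ≤ n + 1 → (η ^ i) s = (ξ ^ i) s) ∧ (η ^ n) s = b ∧ (η ^ (n + 1)) s = z :=
  ⟨fun i hi => (h i hi).symm, by rw [← h n (by omega), hb], by rw [← h (n + 1) le_rfl, hz]⟩

omit [Fintype V] [DecidableEq V] in
/-- Duality: if `ξ⁻¹η` is a cycle then so is `(ξ⁻¹)⁻¹η⁻¹` (the same statement for the inverse permutations). [folklore] -/
theorem isCycle_dual (ξ η : Equiv.Perm V) (h : (ξ⁻¹ * η).IsCycle) : (ξ⁻¹⁻¹ * η⁻¹).IsCycle := by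
  have h1 : (ξ * (ξ⁻¹ * η) * ξ⁻¹)⁻¹.IsCycle := (h.conj).inv
  rwa [mul_inv_cancel_left, mul_inv_rev] at h1

omit [Fintype V] [DecidableEq V] in
/-- Duality for covers: if every cover inside `ξ ∪ η ∪ id` fixing the two gates is trivial, the same holds for `ξ⁻¹ ∪ η⁻¹ ∪ id`.
[folklore] -/
theorem rigid_dual (ξ η : Equiv.Perm V) (b0 b4 : V)
    (H2 : ∀ ρ : Equiv.Perm V, (∀ i, ρ i = i ∨ ρ i = ξ i ∨ ρ i = η i) → ρ b0 = b0 → ρ b4 = b4 → ρ = 1) :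
    ∀ ρ : Equiv.Perm V, (∀ i, ρ i = i ∨ ρ i = ξ⁻¹ i ∨ ρ i = η⁻¹ i) → ρ b0 = b0 → ρ b4 = b4 → ρ = 1 := by
  intro ρ hρ h0 h4
  have key : ρ⁻¹ = 1 := by
    refine H2 ρ⁻¹ (fun j => ?_) (by rw [Equiv.Perm.inv_eq_iff_eq, h0]) (by rw [Equiv.Perm.inv_eq_iff_eq, h4])
    have e : ρ (ρ⁻¹ j) = j := by simp
    rcases hρ (ρ⁻¹ j) with h | h | h
    · left
      rw [e] at h
      exact h.symm
    · right; left
      rw [e, Equiv.Perm.eq_inv_iff_eq] at h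
      exact h.symm
    · right; right
      rw [e, Equiv.Perm.eq_inv_iff_eq] at h
      exact h.symm
  exact inv_eq_one.mp key

end QCover
end Core
end MarkedEdge
end Summit.ValiantsHypothesis.ValiantsHypothesis.Theorems.KPlusLogSqLaw
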